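import Literature.MathematicalPhysics.QuantumLattice.HubbardOneParticleCost
import Literature.MathematicalPhysics.QuantumLattice.HubbardRingPerronFrobeniusProofs
import Literature.MathematicalPhysics.QuantumLattice.TorusPairSusceptibility
import Literature.MathematicalPhysics.QuantumLattice.HubbardHighTemperatureTwoPoint
import HarnessLib

/-!
# The midpoint pair chemical potential is uniformly bounded away from the band edges

Obstruction report, Theorem 11 (auxiliary): the pair chemical potential
`μ̄(N) = ¼[E₀(N+2) − E₀(N−2)]` (sector energies at `S^z = 0`, Lin–Hirsch–Scalapino 1988 eq. (9))
of `hubbardTorus 2 L t U` obeys `|μ̄(N)| ≤ 144 (2|t| + |U|)` for even `N` with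
`N + 2 ≤ L²` and `L² ≤ 4(N − 1)` (densities in `[¼ + O(L⁻²), 1]`), uniformly in `L`.

Ingredients, all from the tree: the one-particle addition / removal costs
`ThermodynamicLimit.groundEnergyAt_succ_le` / `groundEnergyAt_pred_le` (a particle can be added
or removed at cost `≤ (2Δ+1)·2(2|t|+|U|)·2|Λ|/(2|Λ|−N)` resp. `…·2|Λ|/N`), the torus degree bound
`SourceGas.card_filter_fermionTorusGraph_adj_le` (`Δ = 4`), and Lieb's `SU(2)` lemma
`groundEnergyAt_eq_minEnergyOn_szSector` (the `N = 2n` ground energy is attained at `S^z = 0`).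

* `groundEnergyAt_torus_succ_le` — `E(M+1) ≤ E(M) + 36(2|t|+|U|)` for `M + 1 ≤ L²`;
* `groundEnergyAt_torus_pred_le` — `E(M) ≤ E(M+1) + 144(2|t|+|U|)` for `M+1 ≤ 2L²`,
  `L² ≤ 4(M+1)`;
* `abs_pairChemicalPotential_le` — `|μ̄(2m+2)| ≤ 144(2|t|+|U|)` for `2m + 4 ≤ L² ≤ 4(2m+1)`.

Tags: [folklore] (one-particle costs); [this work] for the assembled bound.
-/

namespace Summit.HubbardSuperconductivity.HubbardSuperconductivity.Theorems

open Matrix Finset Literature.MathematicalPhysics.QuantumLattice HubbardWave0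

namespace PairTower

section Torus

-- see `SoloBlindTwistAveraging`: synthesised vs landed `DecidableEq` instances on `Lex`
attribute [-instance] instDecidableEqLex

variable {L : ℕ} [NeZero L]

/-- **One-particle addition cost on the torus**: `E(M+1) ≤ E(M) + 36(2|t|+|U|)` for
`M + 1 ≤ L²` (densities `≤ 1`), from `groundEnergyAt_succ_le` with `Δ = 4` and
`2L²/(2L² − M) ≤ 2`. [folklore] -/
theorem groundEnergyAt_torus_succ_le (t U : ℝ) {M : ℕ} (hM : M + 1 ≤ L ^ 2) :
    groundEnergyAt (fermionTorusGraph 2 L) t U (M + 1) ≤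
      groundEnergyAt (fermionTorusGraph 2 L) t U M + 36 * (2 * |t| + |U|) := by
  have hcard : Fintype.card (FermionTorus 2 L) = L ^ 2 := by simp
  have hM' : M < 2 * Fintype.card (FermionTorus 2 L) := by rw [hcard]; omega
  have h := ThermodynamicLimit.groundEnergyAt_succ_le (fermionTorusGraph 2 L) (Δ := 4)
    (fun x => SourceGas.card_filter_fermionTorusGraph_adj_le x) t U hM'
  refine h.trans ?_
  set V : ℝ := (Fintype.card (FermionTorus 2 L) : ℝ) with hV
  have hMV : (M : ℝ) + 1 ≤ V := by
    rw [hV, hcard]; exact_mod_cast hM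
  have hden : (0 : ℝ) < 2 * V - M := by linarith
  have key : 2 * V / (2 * V - M) ≤ 2 := by
    rw [div_le_iff₀ hden]; linarith
  have htU : (0 : ℝ) ≤ ((2 * 4 + 1 : ℕ) : ℝ) * (2 * (2 * |t| + |U|)) := by positivity
  have hstep : ((2 * 4 + 1 : ℕ) : ℝ) * (2 * (2 * |t| + |U|)) * (2 * V) / (2 * V - M) ≤
      ((2 * 4 + 1 : ℕ) : ℝ) * (2 * (2 * |t| + |U|)) * 2 := by
    rw [mul_div_assoc]
    exact mul_le_mul_of_nonneg_left key htU
  have hval : ((2 * 4 + 1 : ℕ) : ℝ) * (2 * (2 * |t| + |U|)) * 2 = 36 * (2 * |t| + |U|) := by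
    push_cast; ring
  linarith

/-- **One-particle removal cost on the torus**: `E(M) ≤ E(M+1) + 144(2|t|+|U|)` for
`M + 1 ≤ 2L²` and `L² ≤ 4(M+1)` (densities `≥ ¼`), from `groundEnergyAt_pred_le` with `Δ = 4`
and `2L²/(M+1) ≤ 8`. [folklore] -/
theorem groundEnergyAt_torus_pred_le (t U : ℝ) {M : ℕ} (hM : M + 1 ≤ 2 * L ^ 2)
    (hlow : L ^ 2 ≤ 4 * (M + 1)) :
    groundEnergyAt (fermionTorusGraph 2 L) t U M ≤
      groundEnergyAt (fermionTorusGraph 2 L) t U (M + 1) + 144 * (2 * |t| + |U|) := by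
  have hcard : Fintype.card (FermionTorus 2 L) = L ^ 2 := by simp
  have hM' : M + 1 ≤ 2 * Fintype.card (FermionTorus 2 L) := by rw [hcard]; exact hM
  have h := ThermodynamicLimit.groundEnergyAt_pred_le (fermionTorusGraph 2 L) (Δ := 4)
    (fun x => SourceGas.card_filter_fermionTorusGraph_adj_le x) t U (N := M + 1) (by omega) hM'
  rw [Nat.add_sub_cancel] at h
  refine h.trans ?_
  set V : ℝ := (Fintype.card (FermionTorus 2 L) : ℝ) with hV
  have hMV : V ≤ 4 * ((M : ℝ) + 1) := by
    rw [hV, hcard]; exact_mod_cast hlow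
  have hden : (0 : ℝ) < ((M + 1 : ℕ) : ℝ) := by positivity
  have key : 2 * V / ((M + 1 : ℕ) : ℝ) ≤ 8 := by
    rw [div_le_iff₀ hden]; push_cast; linarith
  have htU : (0 : ℝ) ≤ ((2 * 4 + 1 : ℕ) : ℝ) * (2 * (2 * |t| + |U|)) := by positivity
  have hstep : ((2 * 4 + 1 : ℕ) : ℝ) * (2 * (2 * |t| + |U|)) * (2 * V) / ((M + 1 : ℕ) : ℝ) ≤
      ((2 * 4 + 1 : ℕ) : ℝ) * (2 * (2 * |t| + |U|)) * 8 := by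
    rw [mul_div_assoc]
    exact mul_le_mul_of_nonneg_left key htU
  have hval : ((2 * 4 + 1 : ℕ) : ℝ) * (2 * (2 * |t| + |U|)) * 8 = 144 * (2 * |t| + |U|) := by
    push_cast; ring
  linarith

omit [NeZero L] in
/-- The `S^z = 0` sector energy of `hubbardTorus 2 L t U` at even filling `2k ≤ 2L²` is the
`2k`-particle ground energy (Lieb's `SU(2)` lemma). Lieb, PRL 62 (1989) 1201, proof of Thm. 1.
[folklore] -/
theorem minEnergyOn_szSector_eq_groundEnergyAt (t U : ℝ) {k : ℕ} (hk : k ≤ L ^ 2) :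
    (hubbardTorus 2 L t U).minEnergyOn (szSector (2 * k) 0) =
      groundEnergyAt (fermionTorusGraph 2 L) t U (2 * k) := by
  have hk' : k ≤ Fintype.card (FermionTorus 2 L) := by simpa using hk
  exact (groundEnergyAt_eq_minEnergyOn_szSector (fermionTorusGraph 2 L) t U hk').symm

/-- **Uniform bound on the midpoint pair chemical potential.** For `H = hubbardTorus 2 L t U` and
even filling `N = 2m + 2` with `N + 2 ≤ L²` and `L² ≤ 4(N − 1)`:
`|μ̄(N)| = ¼|E₀(N+2) − E₀(N−2)| ≤ 144 (2|t| + |U|)` (four addition steps cost `≤ 36(2|t|+|U|)`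
each, four removal steps `≤ 144(2|t|+|U|)` each). Lin–Hirsch–Scalapino, PRB 37 (1988) 7359,
eq. (9) (definition of `μ̄`). [this work] -/
theorem abs_pairChemicalPotential_le (t U : ℝ) (m : ℕ) (hmL : 2 * m + 4 ≤ L ^ 2)
    (hlow : L ^ 2 ≤ 4 * (2 * m + 1)) :
    |pairChemicalPotential (hubbardTorus 2 L t U) (2 * m + 2)| ≤ 144 * (2 * |t| + |U|) := by
  set E : ℕ → ℝ := fun M => groundEnergyAt (fermionTorusGraph 2 L) t U M with hE
  have e1 : (hubbardTorus 2 L t U).minEnergyOn (szSector (2 * m + 2 + 2) 0) = E (2 * m + 4) := by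
    rw [show 2 * m + 2 + 2 = 2 * (m + 2) by ring, minEnergyOn_szSector_eq_groundEnergyAt t U
      (by omega)]
  have e2 : (hubbardTorus 2 L t U).minEnergyOn (szSector (2 * m + 2 - 2) 0) = E (2 * m) := by
    rw [show 2 * m + 2 - 2 = 2 * m by omega, minEnergyOn_szSector_eq_groundEnergyAt t U
      (by omega)]
  rw [pairChemicalPotential_def, e1, e2]
  -- four steps up
  have u0 : E (2 * m + 1) ≤ E (2 * m) + 36 * (2 * |t| + |U|) :=
    groundEnergyAt_torus_succ_le t U (by omega)
  have u1 : E (2 * m + 2) ≤ E (2 * m + 1) + 36 * (2 * |t| + |U|) :=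
    groundEnergyAt_torus_succ_le t U (by omega)
  have u2 : E (2 * m + 3) ≤ E (2 * m + 2) + 36 * (2 * |t| + |U|) :=
    groundEnergyAt_torus_succ_le t U (by omega)
  have u3 : E (2 * m + 4) ≤ E (2 * m + 3) + 36 * (2 * |t| + |U|) :=
    groundEnergyAt_torus_succ_le t U (by omega)
  -- four steps down
  have d0 : E (2 * m) ≤ E (2 * m + 1) + 144 * (2 * |t| + |U|) :=
    groundEnergyAt_torus_pred_le t U (by omega) (by omega)
  have d1 : E (2 * m + 1) ≤ E (2 * m + 2) + 144 * (2 * |t| + |U|) :=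
    groundEnergyAt_torus_pred_le t U (by omega) (by omega)
  have d2 : E (2 * m + 2) ≤ E (2 * m + 3) + 144 * (2 * |t| + |U|) :=
    groundEnergyAt_torus_pred_le t U (by omega) (by omega)
  have d3 : E (2 * m + 3) ≤ E (2 * m + 4) + 144 * (2 * |t| + |U|) :=
    groundEnergyAt_torus_pred_le t U (by omega) (by omega)
  rw [abs_le]
  constructor <;> linarith

end Torus

end PairTower

end Summit.HubbardSuperconductivity.HubbardSuperconductivity.Theorems
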